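import Summits.QuantumFields.YangMills.Theses.BalabanUVNodes
import Summits.QuantumFields.YangMills.Theorems.BalabanUVNodesN27AtKernelPinnedReading13CoPHFSC

/-!
# ★ K3⁷ LEAF OVER dag-n27-w1's (Kꜰ): THE ITEM `Theses.BalabanUVNodes.SpineGivenEndpointR13SepCoPH` FROM A KERNEL-PINNED STAGE-13 RATE READING IN THE SKELETON's FSC FULL-PREFIX KEY
# (K3⁷ skeleton v5 941dddb108cbaacf, plan g82 l.28564 — v4's `KeyedRatesHolderD4 ∕ PHolderD4 ∕ KeyedCoreEdgeHolderD4 ∕ Keyed*` texts byte-kept in v5; (Kꜰ) = `…N27AtKernelPinnedReading13CoPHFSC`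
# p602540, whose conclusion `HybridNE7Under (datumOfRecord₁₃CoPH F N θ hP) END` per guarded admissible tuple IS the item's body at `N = 2`, `G :=` the item's guard, `hP := h.toCore` — the
# one-line leaf dag-n27-w1 g2 ∕ dag-lead DEDUP-372 §n27 worded to THIS lane, bus l.28346)
# (cell `pub-ymgap`, HUMAN RULING D-0062 Track A, R134 seat `pub-ymgap-dag-n27-c` (N27 B5 composite, s2) gen 13, HOME trigger (t3″); `--kind proof --supports stmt-QuantumFields-20544 --as
# helper`; COUNT-NEUTRAL; THREE theorems, 0 `def`, 0 `sorry`; a route-facing leaf, nothing may import it)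

WHAT THIS LEAF DISPLAYS (`N = 2`, guard `θ.ZhUnity F 2 ∧ θ.SlotsNondegenerate₁₃ F 2`): THE ITEM from, per (Kꜰ) theorem — §1 `…_of_kernels_pin_fsc`: the node-U3 pin `hpin` (the body of v5's
`U3PinnedKernels 𝔯 ℓ`), ONE FSC-keyed binder `hrows` = the three reading-layer rows N14 ∕ N15 ∕ N16-at-β at the selector `ksel` in v5's `KeyedRatesHolderD4` prefix `(B) → END →
ForSmallCouplings D (∀ os, …)`, the tuple-level kernel rows `hs hκ hcr hρ hdec h18 h22` ((D4) ⟸ print's (5.10) clause `KernelDecayOfRecord₁₃ F 2 θ 0 1 κ` + letter inequalities; N18 ∕ N22 at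
the kernel bundle of record; N17 eliminated inside (Kꜰ)), K5 `h20 h21` ∀-keyed at a FREE spine reading `cr`, the N19′ face `h19` FSC-keyed at v5's `PHolderD4 β` SPELLED, N27x `hx`;
§1′ `…_of_letters`: N18 ∕ N22 ∕ (5.10) read off def-W1's four finite-volume kernel letters; §2 `…_of_quadruple_pin_fsc_of_letters`: v4's FOUR definer pins (u3, ne3 ↦ CONSTANT layer, ne2, ne1)
— `hrows` gone, cost = pins + `h16` + four kernel letters + letter rows + `h20 h21 h19 hx`.  The v5 LOOSE-pin edition (`N16PinnedLoose 𝔯 ℓ₃ B`, module 43) is dag-n27-w1's (Kᴸᴾ)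
`hybridNE7Under_of_v5pins_fsc_of_letters` (INTENT-8 l.28541∕l.28579) — its leaf follows it, not typed here.

HONEST FRAMING.  COMPOSITE-node bookkeeping BY NAME; NOT a discharge: three terms of the item's type under displayed hypotheses (audit `proof.conditional`), every one inhabited for
no family today (K0⁷ `Record13SepCoPHInhabited` OPEN); pins are HYPOTHESES on a FREE reading `𝔯` (no reading minted); N14 ∕ N15 behind their pins are DECIDED MODELS (n14-w1's
«budget only» tower reading the datum's scheme; dag-n15-c's carriers), N16-at-β at the constant layer is THE END's content as a hypothesis; the kernel letters are finite-volume statements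
of Bałaban-type SHAPE NOT PRINTED as such for d = 4 ((1.21)'s existence NOT proved; (5.10) of the limiting kernels = print's claim [Balaban1988RG2] p. 293); NE7-cluster, K5, the N19′ edge
0∕1 today; `β`, `ℓ.ρ` LETTERS; nothing of Bałaban's asserted or instantiated; NOT `stub_rates13H` ∕ `stub_expansion13H` (v5's stubs quantify `∃ 𝔯 …` ∕ `∃ jc sh cr, PinnedAtLive …` —
these leaves are per-reading reductions); N14–N18 ∕ N22 ∕ N27 NOT discharged; K3⁷ OPEN, NOT claimed; skeleton v5 and every landed decl UNTOUCHED; counts UNMOVED (typed 28∕28 · discharged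
5∕27, A 5∕28); one finite four-torus programme at fixed `ε` — R4 closes the conditional rung `BalabanLadder.UV` only: NOT ℝ⁴, NOT infinite volume, NOT OS, NOT a mass gap, NOT Clay.
No decl below carries a cite tag.
-/

set_option autoImplicit false

namespace Summit.QuantumFields.YangMills.Theorems.BalabanUVNodesN27SpineRecord

open scoped Matrix.Norms.L2Operator
open Literature.MathematicalPhysics.QuantumFieldTheory.Balaban1983to89
open Literature.MathematicalPhysics.QuantumFieldTheory.Balaban1983to89.T4Continuum
open Literature.MathematicalPhysics.QuantumFieldTheory.Balaban1983to89.B12Sec2to5 (betaPrime510)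
open Literature.MathematicalPhysics.QuantumFieldTheory.Balaban1983to89.Node00.U3OfKernels (objectsOfRecord₁₃ KernelDecayOfRecord₁₃)
open Literature.MathematicalPhysics.QuantumFieldTheory.Balaban1983to89.Node00.U3KernelLetters (PolLimitsExistOfRecord₁₃ WindowedNE9OfRecord₁₃ WindowedDecayOfRecord₁₃
  WindowedStepRateOfRecord₁₃)
open T4WeightBudget (RelWeightBound)
open T4IndicatorShell (ShellWeightBound)
open T4ContinuumYM4Torus (ForSmallCouplings)
open Summit.QuantumFields.BalabanUV.T4Continuum.Spine
open Summit.QuantumFields.YangMills.Theses.BalabanUVNodes (SpineGivenEndpointR13SepCoPH)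
open YMDAG.UVSplit
open Node00 (Stage13HParams datumOfRecord₁₃CoPH U3Letters₁₁ NE3Letters₁₁ ne3ConstLayerOfRecord₁₁)
open Summit.QuantumFields.YangMills.BalabanUVNodes.N16HolderDefs (N16HolderAt)
open Summit.QuantumFields.YangMills.BalabanUVNodes.SpineRatesHolder (RatesHolderAt)
open YMDAG.N14.TopBorn (ne1UnitScale)
open Summit.QuantumFields.YangMills.BalabanUVNodes.N16HolderRegime (InEndRegimeH)
open Summit.QuantumFields.YangMills.BalabanUVNodes.N16LeafSlotAllTorus (LeafSlotHolderAT)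
open Summit.QuantumFields.YangMills.BalabanUVNodes.N15.AtKeyedHome (neZero_blockFactor)
open Summit.QuantumFields.YangMills.BalabanUVNodes.N15.UnitLayerBg (c2BgObjects)

/-! ## §1 THE ITEM from a kernel-pinned reading in v4∕v5's FSC full-prefix key ((Kꜰ) §2 at `N = 2`, `G :=` the item's guard, `hP := h.toCore`) -/

section FSC

variable (cr : (F : T4Family) → (θ : Stage13HParams F 2) → θ.Provisos₁₃CoPH F 2 → (ℕ → ℝ) → List (ULoop F) → SpineCarriers) (𝔯 : RateReading₁₃CoPH 2)
  (ksel : (F : T4Family) → (θ : Stage13HParams F 2) → θ.Provisos₁₃CoPH F 2 → (ℕ → ℝ) → List (ULoop F) → ℕ)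
  (ℓ : (F : T4Family) → Stage13HParams F 2 → U3Letters₁₁) (s : (F : T4Family) → Stage13HParams F 2 → ℕ) (β : ℝ)
  (hpin : ∀ (F : T4Family) (θ : Stage13HParams F 2) (hP : θ.Provisos₁₃CoPH F 2) (g₀ : ℕ → ℝ) (os : List (ULoop F)),
    (𝔯.lit F θ hP g₀ os).u3 = objectsOfRecord₁₃ F 2 θ.toStage13Params (ℓ F θ))
  -- THE THREE READING-LAYER ROWS AT THE SELECTOR, IN v4's FULL-PREFIX KEYING (tuned sequences under (B) ∧ END only)
  (hrows : ∀ (F : T4Family) (θ : Stage13HParams F 2) (hP : θ.Provisos₁₃CoPH F 2), (θ.ZhUnity F 2 ∧ θ.SlotsNondegenerate₁₃ F 2) → θ.Admissible F 2 →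
    B16.EndStatementBPrinted (datumOfRecord₁₃CoPH F 2 θ hP).C → DagBinding.EndpointExistence (datumOfRecord₁₃CoPH F 2 θ hP).C.toB12 →
      ForSmallCouplings (datumOfRecord₁₃CoPH F 2 θ hP) fun g₀ => ∀ os : List (ULoop F),
        N14At (𝔯.ne1 F θ hP g₀ os) ∧ N15At (ne2OfRecord₁₁ ((𝔯.lit F θ hP g₀ os).ne2 (ksel F θ hP g₀ os))) ∧
          N16HolderAt (ne3OfRecord₁₁ F ((𝔯.lit F θ hP g₀ os).ne3 (ksel F θ hP g₀ os))) β)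
  -- letter rows of the U3 letter block, per guarded tuple
  (hs : ∀ (F : T4Family) (θ : Stage13HParams F 2), θ.Provisos₁₃CoPH F 2 → (θ.ZhUnity F 2 ∧ θ.SlotsNondegenerate₁₃ F 2) → θ.Admissible F 2 → (ℓ F θ).Signs)
  (hκ : ∀ (F : T4Family) (θ : Stage13HParams F 2), θ.Provisos₁₃CoPH F 2 → (θ.ZhUnity F 2 ∧ θ.SlotsNondegenerate₁₃ F 2) → θ.Admissible F 2 → 0 < (ℓ F θ).κ)
  (hcr : ∀ (F : T4Family) (θ : Stage13HParams F 2), θ.Provisos₁₃CoPH F 2 → (θ.ZhUnity F 2 ∧ θ.SlotsNondegenerate₁₃ F 2) → θ.Admissible F 2 → betaPrime510 4 1 (ℓ F θ).κ ≤ (ℓ F θ).cr)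
  (hρ : ∀ (F : T4Family) (θ : Stage13HParams F 2), θ.Provisos₁₃CoPH F 2 → (θ.ZhUnity F 2 ∧ θ.SlotsNondegenerate₁₃ F 2) → θ.Admissible F 2 → 0 ≤ (ℓ F θ).ρ ∧ (ℓ F θ).ρ < 1)
  -- K5 (∀-keyed, as v4's `KeyedRelWeight ∕ KeyedShellWeight`), the N19′ face under the prefix at the spelled `PHolderD4 β`, the spine-side representation
  (h20 : ∀ (F : T4Family) (θ : Stage13HParams F 2) (hP : θ.Provisos₁₃CoPH F 2), (θ.ZhUnity F 2 ∧ θ.SlotsNondegenerate₁₃ F 2) → θ.Admissible F 2 → ∀ (g₀ : ℕ → ℝ) (os : List (ULoop F)),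
    RelWeightBound (cr F θ hP g₀ os).l₀ (cr F θ hP g₀ os).T (cr F θ hP g₀ os).A (cr F θ hP g₀ os).B (cr F θ hP g₀ os).Bad (cr F θ hP g₀ os).W)
  (h21 : ∀ (F : T4Family) (θ : Stage13HParams F 2) (hP : θ.Provisos₁₃CoPH F 2), (θ.ZhUnity F 2 ∧ θ.SlotsNondegenerate₁₃ F 2) → θ.Admissible F 2 → ∀ (g₀ : ℕ → ℝ) (os : List (ULoop F)),
    ShellWeightBound (cr F θ hP g₀ os).l₀ (cr F θ hP g₀ os).T (cr F θ hP g₀ os).A (cr F θ hP g₀ os).B (cr F θ hP g₀ os).shA (cr F θ hP g₀ os).shB (cr F θ hP g₀ os).Wsh)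
  (h19 : ∀ (F : T4Family) (θ : Stage13HParams F 2) (hP : θ.Provisos₁₃CoPH F 2), (θ.ZhUnity F 2 ∧ θ.SlotsNondegenerate₁₃ F 2) → θ.Admissible F 2 →
    B16.EndStatementBPrinted (datumOfRecord₁₃CoPH F 2 θ hP).C → DagBinding.EndpointExistence (datumOfRecord₁₃CoPH F 2 θ hP).C.toB12 →
      ForSmallCouplings (datumOfRecord₁₃CoPH F 2 θ hP) fun g₀ => ∀ os : List (ULoop F),
        (RatesHolderAt (datumOfRecord₁₃CoPH F 2 θ hP) (rateCarriersOfRecord₁₃CoPH 𝔯 F θ hP g₀ os (ksel F θ hP g₀ os)) β ∧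
            ReadOutAt (datumOfRecord₁₃CoPH F 2 θ hP) (rateCarriersOfRecord₁₃CoPH 𝔯 F θ hP g₀ os (ksel F θ hP g₀ os)).u3 ∧
            (0 ≤ (rateCarriersOfRecord₁₃CoPH 𝔯 F θ hP g₀ os (ksel F θ hP g₀ os)).u3.ρ ∧ (rateCarriersOfRecord₁₃CoPH 𝔯 F θ hP g₀ os (ksel F θ hP g₀ os)).u3.ρ < 1)) →
          letI := (cr F θ hP g₀ os).dec
          ∃ δ : ℕ → ℝ, NE7.Core (cr F θ hP g₀ os).l₀ (cr F θ hP g₀ os).vol (cr F θ hP g₀ os).T (cr F θ hP g₀ os).Bad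
            (fun K t τ => (cr F θ hP g₀ os).A K t τ - (cr F θ hP g₀ os).shA K t τ) (fun K t τ => (cr F θ hP g₀ os).B K t τ - (cr F θ hP g₀ os).shB K t τ) δ ∧
            Summable δ)
  (hx : ∀ (F : T4Family) (θ : Stage13HParams F 2) (hP : θ.Provisos₁₃CoPH F 2), (θ.ZhUnity F 2 ∧ θ.SlotsNondegenerate₁₃ F 2) → θ.Admissible F 2 →
    B16.EndStatementBPrinted (datumOfRecord₁₃CoPH F 2 θ hP).C → DagBinding.EndpointExistence (datumOfRecord₁₃CoPH F 2 θ hP).C.toB12 →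
      ForSmallCouplings (datumOfRecord₁₃CoPH F 2 θ hP) fun g₀ => ∀ os : List (ULoop F),
        0 < (cr F θ hP g₀ os).l₀ ∧ 0 < (cr F θ hP g₀ os).vol ∧
        (∀ (K : ℕ) (t : ℝ), |t| ≤ (cr F θ hP g₀ os).l₀ →
          T4GenFunBounds.schemeZ ((datumOfRecord₁₃CoPH F 2 θ hP).scheme g₀) os ((cr F θ hP g₀ os).K₀ + K) t =
            ∑ τ ∈ (cr F θ hP g₀ os).T K, (cr F θ hP g₀ os).A K t τ) ∧
        (∀ (K : ℕ) (t : ℝ), |t| ≤ (cr F θ hP g₀ os).l₀ →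
          T4GenFunBounds.schemeZ ((datumOfRecord₁₃CoPH F 2 θ hP).scheme g₀) os ((cr F θ hP g₀ os).K₀ + K + 1) t =
            ∑ τ ∈ (cr F θ hP g₀ os).T K, (cr F θ hP g₀ os).B K t τ))
include hpin hrows hs hκ hcr hρ h20 h21 h19 hx

/-- ★★ **THE ITEM `SpineGivenEndpointR13SepCoPH` FROM A KERNEL-PINNED STAGE-13 RATE READING IN THE SKELETON's FSC FULL-PREFIX KEY** — ONE application per guarded admissible tuple of
dag-n27-w1's (Kꜰ) `hybridNE7Under_of_kernels_pin_fsc` (p602540) at `N = 2`, `G := ZhUnity ∧ SlotsNondegenerate₁₃`, `hP := h.toCore` (`datumOfRecord₁₃SepCoPH F 2 θ h = datumOfRecord₁₃CoPH F 2 θ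
h.toCore` is `rfl`), the item's own `(B)` ∕ endpoint antecedents dropped exactly as v5's composition drops them.  Displayed: the node-U3 pin `hpin` (= v5's `U3PinnedKernels 𝔯 ℓ` body); the
three reading-layer rows N14 ∕ N15 ∕ N16-at-β at the selector in v5's `KeyedRatesHolderD4` prefix (`hrows`); tuple-level kernel rows `hs hκ hcr hρ hdec h18 h22`; K5 `h20 h21` ∀-keyed at a
free `cr`; the N19′ face `h19` FSC-keyed at v5's `PHolderD4 β` SPELLED; N27x `hx`.  NOT a discharge: a term of the item's type under displayed hypotheses (audit `proof.conditional`), each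
inhabited for no family today (K0⁷ OPEN); `cr 𝔯 ksel ℓ β` FREE; no stub of v5 closed. [bookkeeping] -/
theorem spineGivenEndpointR13SepCoPH_of_kernels_pin_fsc
    (hdec : ∀ (F : T4Family) (θ : Stage13HParams F 2), θ.Provisos₁₃CoPH F 2 → (θ.ZhUnity F 2 ∧ θ.SlotsNondegenerate₁₃ F 2) → θ.Admissible F 2 → KernelDecayOfRecord₁₃ F 2 θ.toStage13Params 0 1 (ℓ F θ).κ)
    (h18 : ∀ (F : T4Family) (θ : Stage13HParams F 2), θ.Provisos₁₃CoPH F 2 → (θ.ZhUnity F 2 ∧ θ.SlotsNondegenerate₁₃ F 2) → θ.Admissible F 2 → ∀ k : ℕ,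
      N18At (u3OfRecord₁₃ θ.toStage13Params (objectsOfRecord₁₃ F 2 θ.toStage13Params (ℓ F θ)) k))
    (h22 : ∀ (F : T4Family) (θ : Stage13HParams F 2), θ.Provisos₁₃CoPH F 2 → (θ.ZhUnity F 2 ∧ θ.SlotsNondegenerate₁₃ F 2) → θ.Admissible F 2 → ∀ k : ℕ,
      N22At (u3OfRecord₁₃ θ.toStage13Params (objectsOfRecord₁₃ F 2 θ.toStage13Params (ℓ F θ)) k)) :
    SpineGivenEndpointR13SepCoPH :=
  fun F θ hP hG hθ _ _ =>
    hybridNE7Under_of_kernels_pin_fsc cr 𝔯 ksel (fun {F} (θ : Stage13HParams F 2) => θ.ZhUnity F 2 ∧ θ.SlotsNondegenerate₁₃ F 2) ℓ β hpin hrows hs hκ hcr hρ h20 h21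
      h19 hx hdec h18 h22 F θ hP.toCore hG hθ

/-- ★★ **THE SAME WITH THE U3 ROWS READ OFF def-W1's FOUR FINITE-VOLUME KERNEL LETTERS OF RECORD** ((Kꜰ) `hybridNE7Under_of_kernels_pin_fsc_of_letters`: `PolLimitsExistOfRecord₁₃` ·
`WindowedNE9OfRecord₁₃ … κ moduli` · `WindowedDecayOfRecord₁₃ … 0 1 κ` · `WindowedStepRateOfRecord₁₃ … s κ θ₅ (C₅·θ₅)` per guarded admissible tuple — finite-volume statements of Bałaban-type
SHAPE, NOT PRINTED as such for d = 4).  NOT a discharge; no stub closed. [bookkeeping] -/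
theorem spineGivenEndpointR13SepCoPH_of_kernels_pin_fsc_of_letters
    (hL : ∀ (F : T4Family) (θ : Stage13HParams F 2), θ.Provisos₁₃CoPH F 2 → (θ.ZhUnity F 2 ∧ θ.SlotsNondegenerate₁₃ F 2) → θ.Admissible F 2 → PolLimitsExistOfRecord₁₃ F 2 θ.toStage13Params)
    (h9 : ∀ (F : T4Family) (θ : Stage13HParams F 2), θ.Provisos₁₃CoPH F 2 → (θ.ZhUnity F 2 ∧ θ.SlotsNondegenerate₁₃ F 2) → θ.Admissible F 2 → WindowedNE9OfRecord₁₃ F 2 θ.toStage13Params (ℓ F θ).κ (ℓ F θ).moduli)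
    (hW : ∀ (F : T4Family) (θ : Stage13HParams F 2), θ.Provisos₁₃CoPH F 2 → (θ.ZhUnity F 2 ∧ θ.SlotsNondegenerate₁₃ F 2) → θ.Admissible F 2 → WindowedDecayOfRecord₁₃ F 2 θ.toStage13Params 0 1 (ℓ F θ).κ)
    (hS : ∀ (F : T4Family) (θ : Stage13HParams F 2), θ.Provisos₁₃CoPH F 2 → (θ.ZhUnity F 2 ∧ θ.SlotsNondegenerate₁₃ F 2) → θ.Admissible F 2 →
      WindowedStepRateOfRecord₁₃ F 2 θ.toStage13Params (s F θ) (ℓ F θ).κ (ℓ F θ).θ₅ ((ℓ F θ).C₅ * (ℓ F θ).θ₅)) :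
    SpineGivenEndpointR13SepCoPH :=
  fun F θ hP hG hθ _ _ =>
    hybridNE7Under_of_kernels_pin_fsc_of_letters cr 𝔯 ksel (fun {F} (θ : Stage13HParams F 2) => θ.ZhUnity F 2 ∧ θ.SlotsNondegenerate₁₃ F 2) ℓ s β hpin hrows hs hκ
      hcr hρ h20 h21 h19 hx hL h9 hW hS F θ hP.toCore hG hθ

end FSC

/-! ## §2 THE ITEM from the quadruple-pinned reading ((Kꜰ) §3: v4's four definer pins, the reading-layer FSC binder gone) -/

section Quadruple

variable (cr : (F : T4Family) → (θ : Stage13HParams F 2) → θ.Provisos₁₃CoPH F 2 → (ℕ → ℝ) → List (ULoop F) → SpineCarriers) (𝔯 : RateReading₁₃CoPH 2)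
  (ksel : (F : T4Family) → (θ : Stage13HParams F 2) → θ.Provisos₁₃CoPH F 2 → (ℕ → ℝ) → List (ULoop F) → ℕ)
  (ℓ : (F : T4Family) → Stage13HParams F 2 → U3Letters₁₁) (ℓ₃ : T4Family → NE3Letters₁₁)
  (s : (F : T4Family) → Stage13HParams F 2 → ℕ) {β : ℝ} (hβ0 : 0 ≤ β) (hβ1 : β ≤ 1) {l₀ M Λ : ℝ} (hl₀ : 0 ≤ l₀) (hM : 0 ≤ M) (hΛ : 0 ≤ Λ)
  {b aS : ℝ} (hb : 0 < b) (haS : 0 < aS) {c35 : ℝ} (hc35 : 0 < c35) (α α' : Fin 4) (p : ℝ)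
include hβ0 hβ1 hl₀ hΛ hb haS hc35

/-- ★★★ **THE ITEM FROM THE FULLY-PINNED BILL IN THE FSC KEY** ((Kꜰ) `hybridNE7Under_of_quadruple_pin_fsc_of_letters` at `N = 2`, `G :=` the guard, `hP := h.toCore`): node U3 ↦ def-W1's
kernel objects of record (`hpin`), N16's layer ↦ RR-1's CONSTANT layer at `ℓ₃` (`hpin3` — v4's pin; v5's LOOSE pin `N16PinnedLoose 𝔯 ℓ₃ B` is dag-n27-w1's (Kᴸᴾ) edition, leaf to follow),
N15's layer ↦ dag-n15-c's primitive-carrier family (`hpin2`, MODEL LEVEL), NODE O's tower ↦ dag-n14-w1's top-born unit-scale tower (`hpin1`); then THE ITEM costs EXACTLY: `h16` (β-uniform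
regime ∧ at-keyed leaf β-slot per guarded family at the constant layer) · def-W1's four kernel letters · `Signs ∕ 0 < κ ∕ betaPrime510 4 1 κ ≤ cr ∕ 0 ≤ ρ < 1` · `h20 h21` ∀-keyed at a free `cr` ·
the FSC-keyed N19′ face `h19` at the spelled `PHolderD4 β` · `hx`.  Every row a HYPOTHESIS or a decided MODEL; nothing of Bałaban's proved; no stub closed; N27 NOT discharged. [bookkeeping] -/
theorem spineGivenEndpointR13SepCoPH_of_quadruple_pin_fsc_of_letters
    (hpin : ∀ (F : T4Family) (θ : Stage13HParams F 2) (hP : θ.Provisos₁₃CoPH F 2) (g₀ : ℕ → ℝ) (os : List (ULoop F)),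
      (𝔯.lit F θ hP g₀ os).u3 = objectsOfRecord₁₃ F 2 θ.toStage13Params (ℓ F θ))
    (hpin3 : ∀ (F : T4Family) (θ : Stage13HParams F 2) (hP : θ.Provisos₁₃CoPH F 2) (g₀ : ℕ → ℝ) (os : List (ULoop F)) (k : ℕ),
      (𝔯.lit F θ hP g₀ os).ne3 k = ne3ConstLayerOfRecord₁₁ F 2 (ℓ₃ F))
    (hpin2 : ∀ (F : T4Family) (θ : Stage13HParams F 2) (hP : θ.Provisos₁₃CoPH F 2) (g₀ : ℕ → ℝ) (os : List (ULoop F)) (k : ℕ),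
      (𝔯.lit F θ hP g₀ os).ne2 k = haveI := neZero_blockFactor F; c2BgObjects 3 F.hL b aS α α' c35 p)
    (hpin1 : ∀ (F : T4Family) (θ : Stage13HParams F 2) (hP : θ.Provisos₁₃CoPH F 2) (g₀ : ℕ → ℝ) (os : List (ULoop F)),
      𝔯.ne1 F θ hP g₀ os = ne1UnitScale l₀ M Λ hM F θ hP g₀ os)
    (h16 : ∀ (F : T4Family), (∃ θ : Stage13HParams F 2, θ.Provisos₁₃CoPH F 2 ∧ (θ.ZhUnity F 2 ∧ θ.SlotsNondegenerate₁₃ F 2) ∧ θ.Admissible F 2) →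
      InEndRegimeH (ne3OfRecord₁₁ F (ne3ConstLayerOfRecord₁₁ F 2 (ℓ₃ F))) ∧ LeafSlotHolderAT (ne3OfRecord₁₁ F (ne3ConstLayerOfRecord₁₁ F 2 (ℓ₃ F))) β)
    (hs : ∀ (F : T4Family) (θ : Stage13HParams F 2), θ.Provisos₁₃CoPH F 2 → (θ.ZhUnity F 2 ∧ θ.SlotsNondegenerate₁₃ F 2) → θ.Admissible F 2 → (ℓ F θ).Signs)
    (hκ : ∀ (F : T4Family) (θ : Stage13HParams F 2), θ.Provisos₁₃CoPH F 2 → (θ.ZhUnity F 2 ∧ θ.SlotsNondegenerate₁₃ F 2) → θ.Admissible F 2 → 0 < (ℓ F θ).κ)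
    (hcr : ∀ (F : T4Family) (θ : Stage13HParams F 2), θ.Provisos₁₃CoPH F 2 → (θ.ZhUnity F 2 ∧ θ.SlotsNondegenerate₁₃ F 2) → θ.Admissible F 2 → betaPrime510 4 1 (ℓ F θ).κ ≤ (ℓ F θ).cr)
    (hρ : ∀ (F : T4Family) (θ : Stage13HParams F 2), θ.Provisos₁₃CoPH F 2 → (θ.ZhUnity F 2 ∧ θ.SlotsNondegenerate₁₃ F 2) → θ.Admissible F 2 → 0 ≤ (ℓ F θ).ρ ∧ (ℓ F θ).ρ < 1)
    (hL : ∀ (F : T4Family) (θ : Stage13HParams F 2), θ.Provisos₁₃CoPH F 2 → (θ.ZhUnity F 2 ∧ θ.SlotsNondegenerate₁₃ F 2) → θ.Admissible F 2 → PolLimitsExistOfRecord₁₃ F 2 θ.toStage13Params)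
    (h9 : ∀ (F : T4Family) (θ : Stage13HParams F 2), θ.Provisos₁₃CoPH F 2 → (θ.ZhUnity F 2 ∧ θ.SlotsNondegenerate₁₃ F 2) → θ.Admissible F 2 → WindowedNE9OfRecord₁₃ F 2 θ.toStage13Params (ℓ F θ).κ (ℓ F θ).moduli)
    (hW : ∀ (F : T4Family) (θ : Stage13HParams F 2), θ.Provisos₁₃CoPH F 2 → (θ.ZhUnity F 2 ∧ θ.SlotsNondegenerate₁₃ F 2) → θ.Admissible F 2 → WindowedDecayOfRecord₁₃ F 2 θ.toStage13Params 0 1 (ℓ F θ).κ)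
    (hS : ∀ (F : T4Family) (θ : Stage13HParams F 2), θ.Provisos₁₃CoPH F 2 → (θ.ZhUnity F 2 ∧ θ.SlotsNondegenerate₁₃ F 2) → θ.Admissible F 2 →
      WindowedStepRateOfRecord₁₃ F 2 θ.toStage13Params (s F θ) (ℓ F θ).κ (ℓ F θ).θ₅ ((ℓ F θ).C₅ * (ℓ F θ).θ₅))
    (h20 : ∀ (F : T4Family) (θ : Stage13HParams F 2) (hP : θ.Provisos₁₃CoPH F 2), (θ.ZhUnity F 2 ∧ θ.SlotsNondegenerate₁₃ F 2) → θ.Admissible F 2 → ∀ (g₀ : ℕ → ℝ) (os : List (ULoop F)),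
      RelWeightBound (cr F θ hP g₀ os).l₀ (cr F θ hP g₀ os).T (cr F θ hP g₀ os).A (cr F θ hP g₀ os).B (cr F θ hP g₀ os).Bad (cr F θ hP g₀ os).W)
    (h21 : ∀ (F : T4Family) (θ : Stage13HParams F 2) (hP : θ.Provisos₁₃CoPH F 2), (θ.ZhUnity F 2 ∧ θ.SlotsNondegenerate₁₃ F 2) → θ.Admissible F 2 → ∀ (g₀ : ℕ → ℝ) (os : List (ULoop F)),
      ShellWeightBound (cr F θ hP g₀ os).l₀ (cr F θ hP g₀ os).T (cr F θ hP g₀ os).A (cr F θ hP g₀ os).B (cr F θ hP g₀ os).shA (cr F θ hP g₀ os).shB (cr F θ hP g₀ os).Wsh)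
    (h19 : ∀ (F : T4Family) (θ : Stage13HParams F 2) (hP : θ.Provisos₁₃CoPH F 2), (θ.ZhUnity F 2 ∧ θ.SlotsNondegenerate₁₃ F 2) → θ.Admissible F 2 →
      B16.EndStatementBPrinted (datumOfRecord₁₃CoPH F 2 θ hP).C → DagBinding.EndpointExistence (datumOfRecord₁₃CoPH F 2 θ hP).C.toB12 →
        ForSmallCouplings (datumOfRecord₁₃CoPH F 2 θ hP) fun g₀ => ∀ os : List (ULoop F),
          (RatesHolderAt (datumOfRecord₁₃CoPH F 2 θ hP) (rateCarriersOfRecord₁₃CoPH 𝔯 F θ hP g₀ os (ksel F θ hP g₀ os)) β ∧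
              ReadOutAt (datumOfRecord₁₃CoPH F 2 θ hP) (rateCarriersOfRecord₁₃CoPH 𝔯 F θ hP g₀ os (ksel F θ hP g₀ os)).u3 ∧
              (0 ≤ (rateCarriersOfRecord₁₃CoPH 𝔯 F θ hP g₀ os (ksel F θ hP g₀ os)).u3.ρ ∧ (rateCarriersOfRecord₁₃CoPH 𝔯 F θ hP g₀ os (ksel F θ hP g₀ os)).u3.ρ < 1)) →
            letI := (cr F θ hP g₀ os).dec
            ∃ δ : ℕ → ℝ, NE7.Core (cr F θ hP g₀ os).l₀ (cr F θ hP g₀ os).vol (cr F θ hP g₀ os).T (cr F θ hP g₀ os).Bad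
              (fun K t τ => (cr F θ hP g₀ os).A K t τ - (cr F θ hP g₀ os).shA K t τ) (fun K t τ => (cr F θ hP g₀ os).B K t τ - (cr F θ hP g₀ os).shB K t τ) δ ∧
              Summable δ)
    (hx : ∀ (F : T4Family) (θ : Stage13HParams F 2) (hP : θ.Provisos₁₃CoPH F 2), (θ.ZhUnity F 2 ∧ θ.SlotsNondegenerate₁₃ F 2) → θ.Admissible F 2 →
      B16.EndStatementBPrinted (datumOfRecord₁₃CoPH F 2 θ hP).C → DagBinding.EndpointExistence (datumOfRecord₁₃CoPH F 2 θ hP).C.toB12 →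
        ForSmallCouplings (datumOfRecord₁₃CoPH F 2 θ hP) fun g₀ => ∀ os : List (ULoop F),
          0 < (cr F θ hP g₀ os).l₀ ∧ 0 < (cr F θ hP g₀ os).vol ∧
          (∀ (K : ℕ) (t : ℝ), |t| ≤ (cr F θ hP g₀ os).l₀ →
            T4GenFunBounds.schemeZ ((datumOfRecord₁₃CoPH F 2 θ hP).scheme g₀) os ((cr F θ hP g₀ os).K₀ + K) t =
              ∑ τ ∈ (cr F θ hP g₀ os).T K, (cr F θ hP g₀ os).A K t τ) ∧
          (∀ (K : ℕ) (t : ℝ), |t| ≤ (cr F θ hP g₀ os).l₀ →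
            T4GenFunBounds.schemeZ ((datumOfRecord₁₃CoPH F 2 θ hP).scheme g₀) os ((cr F θ hP g₀ os).K₀ + K + 1) t =
              ∑ τ ∈ (cr F θ hP g₀ os).T K, (cr F θ hP g₀ os).B K t τ)) :
    SpineGivenEndpointR13SepCoPH :=
  fun F θ hP hG hθ _ _ =>
    hybridNE7Under_of_quadruple_pin_fsc_of_letters cr 𝔯 ksel (fun {F} (θ : Stage13HParams F 2) => θ.ZhUnity F 2 ∧ θ.SlotsNondegenerate₁₃ F 2) ℓ ℓ₃ s hβ0 hβ1
      hl₀ hM hΛ hb haS hc35 α α' p hpin hpin3 hpin2 hpin1 h16 hs hκ hcr hρ hL h9 hW hS h20 h21 h19 hx F θ hP.toCore hG hθ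

end Quadruple

end Summit.QuantumFields.YangMills.Theorems.BalabanUVNodesN27SpineRecord
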